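import Summits.HubbardSuperconductivity.HubbardSuperconductivity.Theorems.NodalDiracTwistNodalDiracWeakCouplingConeEnergyLemmas

/-!
# Route `NodalDiracTwist` — crux `NodalDiracWeakCoupling`: first-order energy estimates, core

Helper file for stmt-HubbardSuperconductivity-10370 (`NodalDiracWeakCoupling`), supporting the
stub `stub_coneEnergy` of the line `birth`; continues
`NodalDiracTwistNodalDiracWeakCouplingConeEnergyLemmas`. The abstract two-sided first-order
estimate for a two-fold degenerate lowest sector eigenvalue (Kato, *Perturbation Theory for
Linear Operators* (1966), II §5, reduced to its elementary core): a Hermitian `A` with an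
orthonormal ground pair `e₁, e₂ ∈ K` (`A e_k = E₀ e_k`) and a gap `g ≥ 0` above `E₀` on
`K ∩ {e₁, e₂}^⊥`; a perturbation `B = A + r W + R` (`r ≥ 0`) with form bounds `C_W` for `W` and
`ε_R` for `R` on unit vectors. If `E` is a lower bound of the Rayleigh quotient of `B` on the unit
vectors of `K` which is attained at a unit `ψ ∈ K` with frame weights `c_k = ⟨e_k, ψ⟩`, then
(`core_estimate`), with the pencil data `a, b` of the compression of `W`, `ρ = √(a² + |b|²)` and
`t = √(1 - |c₁|² - |c₂|²)` (the weight of `ψ` outside the plane):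
* `g t² + r D(c) ≤ 2 ε_R + 4 C_W r t`, where `D(c) = ρ (|c₁|² + |c₂|²) + q(c) ≥ 0` is the
  deviation of `c` from the lower eigenline of the pencil (upper bound by the lower eigenvector as
  a test vector, lower bound by the gap), and
* every unit test vector `x₁e₁ + x₂e₂` has `B`-energy `≤ E + 2ρ r + 2 ε_R + 4 C_W r t`.
No new definitions.
-/

-- the mandated namespace `Summit.<Summit>.<Problem>.Theorems` repeats `HubbardSuperconductivity`
-- (single-problem summit, D-0017), which the `dupNamespace` linter flags on every declaration
set_option linter.dupNamespace false

namespace Summit.HubbardSuperconductivity.HubbardSuperconductivity.Theorems.NodalDiracTwist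

open Matrix Complex Literature.MathematicalPhysics.QuantumLattice
open scoped ComplexOrder

variable {ι : Type*} [Fintype ι]

/-! ### Rayleigh quotients of `A + r W + R` -/

/-- `re ⟨ψ, (A + rW + R) ψ⟩ = re ⟨ψ, Aψ⟩ + r re ⟨ψ, Wψ⟩ + re ⟨ψ, Rψ⟩`. [folklore] -/
theorem re_form_perturbed (A W R : Matrix ι ι ℂ) (r : ℝ) (ψ : ι → ℂ) :
    (star ψ ⬝ᵥ (A + (r : ℂ) • W + R) *ᵥ ψ).re =
      (star ψ ⬝ᵥ A *ᵥ ψ).re + r * (star ψ ⬝ᵥ W *ᵥ ψ).re + (star ψ ⬝ᵥ R *ᵥ ψ).re := by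
  rw [add_mulVec, add_mulVec, smul_mulVec, dotProduct_add, dotProduct_add, dotProduct_smul,
    smul_eq_mul, Complex.add_re, Complex.add_re, Complex.re_ofReal_mul]

/-- Energy of a unit test vector `e = x₁e₁ + x₂e₂` in the ground plane of `A`:
`re ⟨e, (A + rW + R) e⟩ = E₀ + r (α + q(x)) + re ⟨e, R e⟩`. [folklore] -/
theorem re_form_perturbed_frame {A : Matrix ι ι ℂ} (W R : Matrix ι ι ℂ) (r E₀ : ℝ)
    {e₁ e₂ : ι → ℂ} (he₁ : star e₁ ⬝ᵥ e₁ = 1) (he₂ : star e₂ ⬝ᵥ e₂ = 1)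
    (he₁₂ : star e₁ ⬝ᵥ e₂ = 0) (hA₁ : A *ᵥ e₁ = ((E₀ : ℝ) : ℂ) • e₁)
    (hA₂ : A *ᵥ e₂ = ((E₀ : ℝ) : ℂ) • e₂) {x₁ x₂ : ℂ} (hx : ‖x₁‖ ^ 2 + ‖x₂‖ ^ 2 = 1)
    {α a : ℝ} {b : ℂ}
    (hα : α = ((star e₁ ⬝ᵥ W *ᵥ e₁).re + (star e₂ ⬝ᵥ W *ᵥ e₂).re) / 2)
    (ha : a = ((star e₁ ⬝ᵥ W *ᵥ e₁).re - (star e₂ ⬝ᵥ W *ᵥ e₂).re) / 2)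
    (hb : b = (star e₁ ⬝ᵥ W *ᵥ e₂ + star (star e₂ ⬝ᵥ W *ᵥ e₁)) / 2) :
    (star (x₁ • e₁ + x₂ • e₂) ⬝ᵥ (A + (r : ℂ) • W + R) *ᵥ (x₁ • e₁ + x₂ • e₂)).re =
      E₀ + r * (α + (a * (‖x₁‖ ^ 2 - ‖x₂‖ ^ 2) + 2 * (starRingEnd ℂ x₁ * x₂ * b).re)) +
        (star (x₁ • e₁ + x₂ • e₂) ⬝ᵥ R *ᵥ (x₁ • e₁ + x₂ • e₂)).re := by
  rw [re_form_perturbed, mulVec_frame_eigen hA₁ hA₂, dotProduct_smul, frame_unit he₁ he₂ he₁₂ hx,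
    smul_eq_mul, mul_one, Complex.ofReal_re, compression_re W e₁ e₂ x₁ x₂ hα ha hb, hx, mul_one]

/-! ### The two lower bounds for a unit vector of the sector -/

/-- **Gap lower bound at the crossing.** `A` Hermitian with orthonormal ground pair `e₁, e₂ ∈ K`
(`A e_k = E₀ e_k`) and gap `g` above `E₀` on `K ∩ {e₁, e₂}^⊥`; then a unit `ψ ∈ K` with frame
weights `c_k = ⟨e_k, ψ⟩` has `re ⟨ψ, Aψ⟩ ≥ E₀ + g (1 - |c₁|² - |c₂|²)` (the cross terms between
the plane and its orthocomplement vanish by Hermitian symmetry). [folklore] -/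
theorem re_form_ge_gap (K : Submodule ℂ (ι → ℂ)) {A : Matrix ι ι ℂ} (hA : A.IsHermitian)
    {E₀ g : ℝ} {e₁ e₂ : ι → ℂ} (he₁K : e₁ ∈ K) (he₂K : e₂ ∈ K) (he₁ : star e₁ ⬝ᵥ e₁ = 1)
    (he₂ : star e₂ ⬝ᵥ e₂ = 1) (he₁₂ : star e₁ ⬝ᵥ e₂ = 0)
    (hA₁ : A *ᵥ e₁ = ((E₀ : ℝ) : ℂ) • e₁) (hA₂ : A *ᵥ e₂ = ((E₀ : ℝ) : ℂ) • e₂)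
    (hgap : ∀ χ ∈ K, star e₁ ⬝ᵥ χ = 0 → star e₂ ⬝ᵥ χ = 0 → star χ ⬝ᵥ χ = 1 →
      E₀ + g ≤ (star χ ⬝ᵥ A *ᵥ χ).re)
    {ψ : ι → ℂ} (hψK : ψ ∈ K) (hψ : star ψ ⬝ᵥ ψ = 1) :
    E₀ + g * (1 - ‖star e₁ ⬝ᵥ ψ‖ ^ 2 - ‖star e₂ ⬝ᵥ ψ‖ ^ 2) ≤ (star ψ ⬝ᵥ A *ᵥ ψ).re := by
  obtain ⟨c₁, hc₁⟩ : ∃ c, star e₁ ⬝ᵥ ψ = c := ⟨_, rfl⟩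
  obtain ⟨c₂, hc₂⟩ : ∃ c, star e₂ ⬝ᵥ ψ = c := ⟨_, rfl⟩
  obtain ⟨h₁, h₂, hχχ⟩ := frame_decomp he₁ he₂ he₁₂ hψ hc₁ hc₂
  rw [hc₁, hc₂]
  have hχK : ψ - (c₁ • e₁ + c₂ • e₂) ∈ K :=
    K.sub_mem hψK (K.add_mem (K.smul_mem _ he₁K) (K.smul_mem _ he₂K))
  obtain ⟨χ, hχ⟩ : ∃ χ : ι → ℂ, ψ - (c₁ • e₁ + c₂ • e₂) = χ := ⟨_, rfl⟩
  rw [hχ] at h₁ h₂ hχχ hχK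
  obtain ⟨v, hv⟩ : ∃ v : ι → ℂ, c₁ • e₁ + c₂ • e₂ = v := ⟨_, rfl⟩
  have hAv : A *ᵥ v = ((E₀ : ℝ) : ℂ) • v := hv ▸ mulVec_frame_eigen hA₁ hA₂ c₁ c₂
  have hvv : star v ⬝ᵥ v = ((‖c₁‖ ^ 2 + ‖c₂‖ ^ 2 : ℝ) : ℂ) :=
    hv ▸ frame_normSq he₁ he₂ he₁₂ c₁ c₂
  have hvχ : star v ⬝ᵥ χ = 0 := by
    rw [← hv, star_frame_dotProduct, h₁, h₂, mul_zero, mul_zero, add_zero]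
  have hχv : star χ ⬝ᵥ v = 0 := by rw [star_dotProduct_comm_conj v χ, hvχ, map_zero]
  have hψvχ : ψ = v + χ := by rw [← hχ, ← hv, add_sub_cancel]
  -- `re ⟨ψ, Aψ⟩ = E₀ |c|² + re ⟨χ, Aχ⟩`
  have hexp : (star ψ ⬝ᵥ A *ᵥ ψ).re = E₀ * (‖c₁‖ ^ 2 + ‖c₂‖ ^ 2) + (star χ ⬝ᵥ A *ᵥ χ).re := by
    rw [hψvχ, mulVec_add, star_add, add_dotProduct, dotProduct_add, dotProduct_add, hAv,
      dotProduct_smul, dotProduct_smul, hvv, hχv, smul_zero, zero_add,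
      star_eigen_dotProduct_mulVec hA hAv χ, hvχ, mul_zero, add_zero, smul_eq_mul,
      ← Complex.ofReal_mul, Complex.add_re, Complex.ofReal_re]
  -- the gap on `χ / ‖χ‖`
  have hgapχ : (E₀ + g) * (star χ ⬝ᵥ χ).re ≤ (star χ ⬝ᵥ A *ᵥ χ).re := by
    by_cases hχ0 : χ = 0
    · simp [hχ0]
    have hN := EigenvalueContinuation.re_star_dotProduct_self_pos hχ0
    have hunit := star_dotProduct_self_normalize hχ0
    obtain ⟨t, ht⟩ : ∃ t : ℝ, Real.sqrt (star χ ⬝ᵥ χ).re = t := ⟨_, rfl⟩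
    have ht2 : (star χ ⬝ᵥ χ).re = t ^ 2 := by rw [← ht, Real.sq_sqrt hN.le]
    have ht0 : 0 < t := by rw [← ht]; exact Real.sqrt_pos.2 hN
    rw [ht] at hunit
    have hmemK : (((t⁻¹ : ℝ) : ℂ) • χ) ∈ K := K.smul_mem _ hχK
    have ho₁ : star e₁ ⬝ᵥ (((t⁻¹ : ℝ) : ℂ) • χ) = 0 := by rw [dotProduct_smul, h₁, smul_zero]
    have ho₂ : star e₂ ⬝ᵥ (((t⁻¹ : ℝ) : ℂ) • χ) = 0 := by rw [dotProduct_smul, h₂, smul_zero]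
    have hg := hgap _ hmemK ho₁ ho₂ hunit
    rw [star_smul_dotProduct_mulVec_smul, Complex.conj_ofReal, ← Complex.ofReal_mul,
      Complex.re_ofReal_mul] at hg
    rw [ht2]
    have h := mul_le_mul_of_nonneg_left hg (sq_nonneg t)
    calc (E₀ + g) * t ^ 2 = t ^ 2 * (E₀ + g) := by ring
      _ ≤ t ^ 2 * (t⁻¹ * t⁻¹ * (star χ ⬝ᵥ A *ᵥ χ).re) := h
      _ = (star χ ⬝ᵥ A *ᵥ χ).re := by field_simp
  rw [hexp]
  rw [hχχ] at hgapχ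
  linarith

/-- **Perturbation term against the plane component.** For a unit `ψ = v + χ` (`v = c₁e₁ + c₂e₂`
its component in the plane of `e₁, e₂`, `‖χ‖ = √(1 - |c₁|² - |c₂|²)`) and a matrix `W` with form
bound `C_W ≥ 0` on unit vectors: `re ⟨ψ, Wψ⟩ ≥ re ⟨v, Wv⟩ - 3 C_W ‖χ‖` (Cauchy–Schwarz on the
three cross terms). [folklore] -/
theorem re_form_ge_frame (W : Matrix ι ι ℂ) {C : ℝ} (hC : 0 ≤ C)
    (hW : ∀ x w : ι → ℂ, star x ⬝ᵥ x = 1 → star w ⬝ᵥ w = 1 → ‖star x ⬝ᵥ W *ᵥ w‖ ≤ C)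
    {e₁ e₂ : ι → ℂ} (he₁ : star e₁ ⬝ᵥ e₁ = 1) (he₂ : star e₂ ⬝ᵥ e₂ = 1)
    (he₁₂ : star e₁ ⬝ᵥ e₂ = 0) {ψ : ι → ℂ} (hψ : star ψ ⬝ᵥ ψ = 1) :
    (star ((star e₁ ⬝ᵥ ψ) • e₁ + (star e₂ ⬝ᵥ ψ) • e₂) ⬝ᵥ
          W *ᵥ ((star e₁ ⬝ᵥ ψ) • e₁ + (star e₂ ⬝ᵥ ψ) • e₂)).re -
        3 * C * Real.sqrt (1 - ‖star e₁ ⬝ᵥ ψ‖ ^ 2 - ‖star e₂ ⬝ᵥ ψ‖ ^ 2) ≤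
      (star ψ ⬝ᵥ W *ᵥ ψ).re := by
  obtain ⟨c₁, hc₁⟩ : ∃ c, star e₁ ⬝ᵥ ψ = c := ⟨_, rfl⟩
  obtain ⟨c₂, hc₂⟩ : ∃ c, star e₂ ⬝ᵥ ψ = c := ⟨_, rfl⟩
  obtain ⟨h₁, h₂, hχχ⟩ := frame_decomp he₁ he₂ he₁₂ hψ hc₁ hc₂
  rw [hc₁, hc₂]
  obtain ⟨χ, hχ⟩ : ∃ χ : ι → ℂ, ψ - (c₁ • e₁ + c₂ • e₂) = χ := ⟨_, rfl⟩
  rw [hχ] at h₁ h₂ hχχ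
  obtain ⟨v, hv⟩ : ∃ v : ι → ℂ, c₁ • e₁ + c₂ • e₂ = v := ⟨_, rfl⟩
  have hvv : (star v ⬝ᵥ v).re = ‖c₁‖ ^ 2 + ‖c₂‖ ^ 2 := by
    rw [← hv, frame_normSq he₁ he₂ he₁₂, Complex.ofReal_re]
  rw [hv]
  have hψvχ : ψ = v + χ := by rw [← hχ, ← hv, add_sub_cancel]
  obtain ⟨t, ht⟩ : ∃ t : ℝ, Real.sqrt (1 - ‖c₁‖ ^ 2 - ‖c₂‖ ^ 2) = t := ⟨_, rfl⟩
  rw [ht]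
  have htχ : Real.sqrt (star χ ⬝ᵥ χ).re = t := by rw [hχχ, ht]
  have h0 : 0 ≤ 1 - ‖c₁‖ ^ 2 - ‖c₂‖ ^ 2 :=
    hχχ ▸ EigenvalueContinuation.re_star_dotProduct_self_nonneg χ
  have ht0 : 0 ≤ t := ht ▸ Real.sqrt_nonneg _
  have ht1 : t ≤ 1 := by
    rw [← ht, Real.sqrt_le_one]
    nlinarith [norm_nonneg c₁, norm_nonneg c₂]
  have htt : t * t = 1 - ‖c₁‖ ^ 2 - ‖c₂‖ ^ 2 := by rw [← ht, Real.mul_self_sqrt h0]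
  have hnv : Real.sqrt (star v ⬝ᵥ v).re ≤ 1 := by
    rw [hvv, Real.sqrt_le_one]
    linarith
  have hnv0 : 0 ≤ Real.sqrt (star v ⬝ᵥ v).re := Real.sqrt_nonneg _
  -- the three cross terms
  have b1 : ‖star v ⬝ᵥ W *ᵥ χ‖ ≤ C * t := by
    have h := norm_form_le_of_unit W hW v χ
    rw [htχ] at h
    calc ‖star v ⬝ᵥ W *ᵥ χ‖ ≤ C * Real.sqrt (star v ⬝ᵥ v).re * t := h
      _ ≤ C * 1 * t := by gcongr
      _ = C * t := by ring
  have b2 : ‖star χ ⬝ᵥ W *ᵥ v‖ ≤ C * t := by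
    have h := norm_form_le_of_unit W hW χ v
    rw [htχ] at h
    calc ‖star χ ⬝ᵥ W *ᵥ v‖ ≤ C * t * Real.sqrt (star v ⬝ᵥ v).re := h
      _ ≤ C * t * 1 := by gcongr
      _ = C * t := by ring
  have b3 : ‖star χ ⬝ᵥ W *ᵥ χ‖ ≤ C * t := by
    have h := norm_form_le_of_unit W hW χ χ
    rw [htχ] at h
    calc ‖star χ ⬝ᵥ W *ᵥ χ‖ ≤ C * t * t := h
      _ ≤ C * t * 1 := by gcongr
      _ = C * t := by ring
  have hexp : star ψ ⬝ᵥ W *ᵥ ψ =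
      star v ⬝ᵥ W *ᵥ v + star v ⬝ᵥ W *ᵥ χ + (star χ ⬝ᵥ W *ᵥ v + star χ ⬝ᵥ W *ᵥ χ) := by
    rw [hψvχ, mulVec_add, star_add, add_dotProduct, dotProduct_add, dotProduct_add]
  rw [hexp, Complex.add_re, Complex.add_re, Complex.add_re]
  have r1 := (abs_le.1 ((Complex.abs_re_le_norm _).trans b1)).1
  have r2 := (abs_le.1 ((Complex.abs_re_le_norm _).trans b2)).1
  have r3 := (abs_le.1 ((Complex.abs_re_le_norm _).trans b3)).1
  linarith

/-! ### Bounds on the pencil data -/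

/-- The pencil data of a form-bounded `W` are bounded: `|α| ≤ C_W`, `ρ = √(a² + |b|²) ≤ 2 C_W`.
[folklore] -/
theorem pencil_coeff_bounds (W : Matrix ι ι ℂ) {C : ℝ}
    (hW : ∀ x w : ι → ℂ, star x ⬝ᵥ x = 1 → star w ⬝ᵥ w = 1 → ‖star x ⬝ᵥ W *ᵥ w‖ ≤ C)
    {e₁ e₂ : ι → ℂ} (he₁ : star e₁ ⬝ᵥ e₁ = 1) (he₂ : star e₂ ⬝ᵥ e₂ = 1) {α a : ℝ} {b : ℂ}
    (hα : α = ((star e₁ ⬝ᵥ W *ᵥ e₁).re + (star e₂ ⬝ᵥ W *ᵥ e₂).re) / 2)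
    (ha : a = ((star e₁ ⬝ᵥ W *ᵥ e₁).re - (star e₂ ⬝ᵥ W *ᵥ e₂).re) / 2)
    (hb : b = (star e₁ ⬝ᵥ W *ᵥ e₂ + star (star e₂ ⬝ᵥ W *ᵥ e₁)) / 2) :
    |α| ≤ C ∧ Real.sqrt (a ^ 2 + ‖b‖ ^ 2) ≤ 2 * C := by
  have h11 := (Complex.abs_re_le_norm _).trans (hW e₁ e₁ he₁ he₁)
  have h22 := (Complex.abs_re_le_norm _).trans (hW e₂ e₂ he₂ he₂)
  have h12 := hW e₁ e₂ he₁ he₂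
  have h21 := hW e₂ e₁ he₂ he₁
  have hαC : |α| ≤ C := by
    rw [hα, abs_div, abs_two]
    have h := abs_add_le (star e₁ ⬝ᵥ W *ᵥ e₁).re (star e₂ ⬝ᵥ W *ᵥ e₂).re
    linarith
  have haC : |a| ≤ C := by
    rw [ha, abs_div, abs_two]
    have h := abs_sub (star e₁ ⬝ᵥ W *ᵥ e₁).re (star e₂ ⬝ᵥ W *ᵥ e₂).re
    linarith
  have hbC : ‖b‖ ≤ C := by
    rw [hb, norm_div, Complex.norm_two]
    have h := norm_add_le (star e₁ ⬝ᵥ W *ᵥ e₂) (star (star e₂ ⬝ᵥ W *ᵥ e₁))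
    rw [norm_star] at h
    linarith
  refine ⟨hαC, ?_⟩
  have hC : 0 ≤ C := (abs_nonneg a).trans haC
  have ha2 : a ^ 2 ≤ C ^ 2 := by
    rw [← sq_abs]
    exact pow_le_pow_left₀ (abs_nonneg a) haC 2
  have hb2 : ‖b‖ ^ 2 ≤ C ^ 2 := pow_le_pow_left₀ (norm_nonneg b) hbC 2
  rw [Real.sqrt_le_left (by linarith)]
  nlinarith

/-! ### The two-sided first-order estimate -/

/-- **Core estimate** (first-order perturbation of a two-fold degenerate lowest sector eigenvalue,
Kato (1966) II §5, elementary form). Setting as in the module docstring: `B = A + rW + R`,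
`E ≤` Rayleigh quotient of `B` on unit vectors of `K`, attained at the unit `ψ ∈ K` with frame
weights `c_k = ⟨e_k, ψ⟩`, `t = √(1 - |c₁|² - |c₂|²)`, pencil data `a, b`, `ρ = √(a² + |b|²)`.
Then (1) `g t² + r (ρ|c|² + q(c)) ≤ 2ε_R + 4 C_W r t` and (2) every unit test vector of the plane
has `B`-energy at most `E + 2ρ r + 2ε_R + 4 C_W r t`. UPPER BOUND: the lower eigenvector `x` of
the pencil (`q(x) = -ρ`) gives `E ≤ E₀ + r(α - ρ) + ε_R`; LOWER BOUND:
`E = re ⟨ψ, Bψ⟩ ≥ E₀ + g t² + r(α|c|² + q(c) - 3 C_W t) - ε_R`. [folklore] -/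
theorem core_estimate {ι : Type*} [Fintype ι] (K : Submodule ℂ (ι → ℂ)) {A W R : Matrix ι ι ℂ}
    (hA : A.IsHermitian)
    {E₀ g r C εR E : ℝ} (hg : 0 ≤ g) (hr : 0 ≤ r) (hC : 0 ≤ C)
    {e₁ e₂ : ι → ℂ} (he₁K : e₁ ∈ K) (he₂K : e₂ ∈ K) (he₁ : star e₁ ⬝ᵥ e₁ = 1)
    (he₂ : star e₂ ⬝ᵥ e₂ = 1) (he₁₂ : star e₁ ⬝ᵥ e₂ = 0)
    (hA₁ : A *ᵥ e₁ = ((E₀ : ℝ) : ℂ) • e₁) (hA₂ : A *ᵥ e₂ = ((E₀ : ℝ) : ℂ) • e₂)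
    (hgap : ∀ χ ∈ K, star e₁ ⬝ᵥ χ = 0 → star e₂ ⬝ᵥ χ = 0 → star χ ⬝ᵥ χ = 1 →
      E₀ + g ≤ (star χ ⬝ᵥ A *ᵥ χ).re)
    (hW : ∀ x w : ι → ℂ, star x ⬝ᵥ x = 1 → star w ⬝ᵥ w = 1 → ‖star x ⬝ᵥ W *ᵥ w‖ ≤ C)
    (hR : ∀ x w : ι → ℂ, star x ⬝ᵥ x = 1 → star w ⬝ᵥ w = 1 → ‖star x ⬝ᵥ R *ᵥ w‖ ≤ εR)
    (hlb : ∀ v ∈ K, star v ⬝ᵥ v = 1 → E ≤ (star v ⬝ᵥ (A + (r : ℂ) • W + R) *ᵥ v).re)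
    {ψ : ι → ℂ} (hψK : ψ ∈ K) (hψ : star ψ ⬝ᵥ ψ = 1)
    (hψE : (star ψ ⬝ᵥ (A + (r : ℂ) • W + R) *ᵥ ψ).re = E) {a : ℝ} {b : ℂ}
    (ha : a = ((star e₁ ⬝ᵥ W *ᵥ e₁).re - (star e₂ ⬝ᵥ W *ᵥ e₂).re) / 2)
    (hb : b = (star e₁ ⬝ᵥ W *ᵥ e₂ + star (star e₂ ⬝ᵥ W *ᵥ e₁)) / 2) :
    (g * (1 - ‖star e₁ ⬝ᵥ ψ‖ ^ 2 - ‖star e₂ ⬝ᵥ ψ‖ ^ 2) +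
        r * (Real.sqrt (a ^ 2 + ‖b‖ ^ 2) * (‖star e₁ ⬝ᵥ ψ‖ ^ 2 + ‖star e₂ ⬝ᵥ ψ‖ ^ 2) +
          a * (‖star e₁ ⬝ᵥ ψ‖ ^ 2 - ‖star e₂ ⬝ᵥ ψ‖ ^ 2) +
          2 * (starRingEnd ℂ (star e₁ ⬝ᵥ ψ) * (star e₂ ⬝ᵥ ψ) * b).re) ≤
      2 * εR + 4 * C * r * Real.sqrt (1 - ‖star e₁ ⬝ᵥ ψ‖ ^ 2 - ‖star e₂ ⬝ᵥ ψ‖ ^ 2)) ∧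
    ∀ x₁ x₂ : ℂ, ‖x₁‖ ^ 2 + ‖x₂‖ ^ 2 = 1 →
      (star (x₁ • e₁ + x₂ • e₂) ⬝ᵥ (A + (r : ℂ) • W + R) *ᵥ (x₁ • e₁ + x₂ • e₂)).re ≤
        E + 2 * Real.sqrt (a ^ 2 + ‖b‖ ^ 2) * r + 2 * εR +
          4 * C * r * Real.sqrt (1 - ‖star e₁ ⬝ᵥ ψ‖ ^ 2 - ‖star e₂ ⬝ᵥ ψ‖ ^ 2) := by
  -- the two lower bounds and the frame weight, then name the frame weights `c₁, c₂`
  have hgapψ := re_form_ge_gap K hA he₁K he₂K he₁ he₂ he₁₂ hA₁ hA₂ hgap hψK hψ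
  have hWψ := re_form_ge_frame W hC hW he₁ he₂ he₁₂ hψ
  have hS1 := frame_weight_le_one he₁ he₂ he₁₂ hψ
  obtain ⟨c₁, hc₁⟩ : ∃ c, star e₁ ⬝ᵥ ψ = c := ⟨_, rfl⟩
  obtain ⟨c₂, hc₂⟩ : ∃ c, star e₂ ⬝ᵥ ψ = c := ⟨_, rfl⟩
  rw [hc₁, hc₂] at hgapψ hWψ hS1 ⊢
  -- pencil data
  obtain ⟨α, hα⟩ : ∃ α : ℝ, α = ((star e₁ ⬝ᵥ W *ᵥ e₁).re + (star e₂ ⬝ᵥ W *ᵥ e₂).re) / 2 :=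
    ⟨_, rfl⟩
  have hcomp := compression_re W e₁ e₂ c₁ c₂ hα ha hb
  obtain ⟨hαC, hρC⟩ := pencil_coeff_bounds W hW he₁ he₂ hα ha hb
  obtain ⟨ρ, hρ⟩ : ∃ ρ : ℝ, Real.sqrt (a ^ 2 + ‖b‖ ^ 2) = ρ := ⟨_, rfl⟩
  have hρ0 : 0 ≤ ρ := hρ ▸ Real.sqrt_nonneg _
  have hqc : -(ρ * (‖c₁‖ ^ 2 + ‖c₂‖ ^ 2)) ≤
      a * (‖c₁‖ ^ 2 - ‖c₂‖ ^ 2) + 2 * (starRingEnd ℂ c₁ * c₂ * b).re :=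
    (abs_le.1 (hρ ▸ abs_pencil_le a b c₁ c₂)).1
  rw [hρ] at hρC ⊢
  -- the weight outside the plane
  obtain ⟨t, ht⟩ : ∃ t : ℝ, Real.sqrt (1 - ‖c₁‖ ^ 2 - ‖c₂‖ ^ 2) = t := ⟨_, rfl⟩
  rw [ht] at hWψ ⊢
  have h0 : 0 ≤ 1 - ‖c₁‖ ^ 2 - ‖c₂‖ ^ 2 := by linarith
  have ht0 : 0 ≤ t := ht ▸ Real.sqrt_nonneg _
  have ht1 : t ≤ 1 := by
    rw [← ht, Real.sqrt_le_one]
    nlinarith [norm_nonneg c₁, norm_nonneg c₂]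
  have htt : t * t = 1 - ‖c₁‖ ^ 2 - ‖c₂‖ ^ 2 := by rw [← ht, Real.mul_self_sqrt h0]
  have htt1 : t * t ≤ t := by nlinarith
  -- the `R` term and the splitting of `E`
  have hRψ : -εR ≤ (star ψ ⬝ᵥ R *ᵥ ψ).re :=
    (abs_le.1 ((Complex.abs_re_le_norm _).trans (hR ψ ψ hψ hψ))).1
  have hE : E = (star ψ ⬝ᵥ A *ᵥ ψ).re + r * (star ψ ⬝ᵥ W *ᵥ ψ).re + (star ψ ⬝ᵥ R *ᵥ ψ).re := by
    rw [← hψE, re_form_perturbed]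
  -- LOWER BOUND
  have hL : E₀ + g * (1 - ‖c₁‖ ^ 2 - ‖c₂‖ ^ 2) +
      r * (α * (‖c₁‖ ^ 2 + ‖c₂‖ ^ 2) +
        (a * (‖c₁‖ ^ 2 - ‖c₂‖ ^ 2) + 2 * (starRingEnd ℂ c₁ * c₂ * b).re)) -
      3 * C * r * t - εR ≤ E := by
    have h := mul_le_mul_of_nonneg_left hWψ hr
    rw [hcomp] at h
    rw [hE]
    linarith
  -- UPPER BOUND by the lower eigenvector of the pencil
  obtain ⟨x₁, x₂, hx, hqx⟩ := exists_pencil_eq_neg_sqrt a b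
  have hU : E ≤ E₀ + r * (α - ρ) + εR := by
    have hunit := frame_unit he₁ he₂ he₁₂ hx
    have h1 := hlb _ (K.add_mem (K.smul_mem _ he₁K) (K.smul_mem _ he₂K)) hunit
    rw [re_form_perturbed_frame W R r E₀ he₁ he₂ he₁₂ hA₁ hA₂ hx hα ha hb, hqx, hρ] at h1
    have h2 := (abs_le.1 ((Complex.abs_re_le_norm _).trans (hR _ _ hunit hunit))).2
    linarith
  -- `|α| t² ≤ C t`
  have hαt : r * (|α| * (1 - ‖c₁‖ ^ 2 - ‖c₂‖ ^ 2)) ≤ r * (C * t) := by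
    refine mul_le_mul_of_nonneg_left ?_ hr
    rw [← htt]
    nlinarith [abs_nonneg α]
  have hα1 := le_abs_self α
  have hα2 := neg_abs_le α
  refine ⟨?_, fun y₁ y₂ hy => ?_⟩
  · -- (1): `(L) - (U)`, then `(α - ρ) t² ≤ |α| t² ≤ C t`
    have h3 : r * ((α - ρ) * (1 - ‖c₁‖ ^ 2 - ‖c₂‖ ^ 2)) ≤
        r * (|α| * (1 - ‖c₁‖ ^ 2 - ‖c₂‖ ^ 2)) := by
      refine mul_le_mul_of_nonneg_left (mul_le_mul_of_nonneg_right ?_ h0) hr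
      linarith
    linarith [hL, hU, h3, hαt]
  · -- (2): test vector energy `≤ E₀ + r(α + ρ) + ε_R`, and `E ≥ E₀ + r(α - ρ) - 4 C r t - ε_R`
    have hunit := frame_unit he₁ he₂ he₁₂ hy
    rw [re_form_perturbed_frame W R r E₀ he₁ he₂ he₁₂ hA₁ hA₂ hy hα ha hb]
    have h2 := (abs_le.1 ((Complex.abs_re_le_norm _).trans (hR _ _ hunit hunit))).2
    have hqy := mul_le_mul_of_nonneg_left (pencil_le_sqrt a b hy) hr
    rw [hρ] at hqy
    have hq1 := mul_le_mul_of_nonneg_left hqc hr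
    have h3 : r * ((ρ - α) * (1 - ‖c₁‖ ^ 2 - ‖c₂‖ ^ 2)) ≥
        r * (-(|α| * (1 - ‖c₁‖ ^ 2 - ‖c₂‖ ^ 2))) := by
      refine mul_le_mul_of_nonneg_left ?_ hr
      rw [neg_mul_eq_neg_mul]
      exact mul_le_mul_of_nonneg_right (by linarith) h0
    have hgt : 0 ≤ g * (1 - ‖c₁‖ ^ 2 - ‖c₂‖ ^ 2) := mul_nonneg hg h0
    linarith [hL, h2, hqy, hq1, h3, hαt, hgt]

end Summit.HubbardSuperconductivity.HubbardSuperconductivity.Theorems.NodalDiracTwist
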